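import Summits.AtomisticToContinuum.Crystallization.Theorems.OverbindingBudgetAffineFarFieldCellAffine

/-!
# OverbindingBudget (2c) — part 27Vb-V(B1): loose moment cells and their quadrature rule (lens-4 g96; r1673 S3, r1684 η)

Support file, pure analysis on `ℝ³ = EuclideanSpace ℝ (Fin 3)`, no atlas.  Scheme B («27V-TWICE»,
DESK27V-g94 §1) expands the kernel over the TRUE Voronoi cell `K_p` of every far site about the ACTUAL
site position `y_p`.  Such a cell is not an exact moment cell in the sense of part 27Va-B
(`IsMomentCell`: exact centroid clause `∫_K (x − p) = 0`): its centroid is off by `O(ε)` (desk item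
`E_cen`).  Rather than expanding about the centroid (which would move the expansion point off the site and
cost a second bookkeeping layer), the centroid clause is RELAXED and paid for at first order:

* `IsLooseMomentCell K p η σ δ μ₃ μ₄` — `IsMomentCell` with the centroid clause replaced by
  `‖∫_K (x − p)‖ ≤ η·|K|`; `IsMomentCell.loose` (the `η = 0` embedding: the ideal-cell data of parts
  27Vb-K — `isMomentCell_rdCell_nu`, `isMomentCell_trdCell_nu` and their moved / affine images — feed it
  unchanged) and `IsLooseMomentCell.of_le` (rounding constants up);
* `cell_taylor_loose` / `cell_taylor_loose_tau` — the cell quadrature rule with the extra first-order term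
  `η·‖Dg(p)‖` (`T₁`-integral `= Dg(p)[∫_K (x − p)]` by `ContinuousLinearMap.integral_comp_comm`):
  `|∫_K g − |K|(g(p) + (σ/2)Δg(p))| ≤ |K|(η D₁ + (δ/2) D₂ + (τ/6) D₃ + (μ₄/24) D₄)`
  (`τ = μ₃` in general, the structured cubic constant in the `_tau` form);
* `cubic_clause_of_centrallySymmetric` — a centrally symmetric cell satisfies the structured cubic clause
  with `τ = 0`, so `k`-cells (rhombic dodecahedra) and `h`-cells (trapezo-rhombic dodecahedra,
  `τ = 7ν³/(360√2)`, part 27Vb-K3w) are consumed through ONE interface.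

The actual-cell SANDWICH (how a true Voronoi cell acquires loose data from the ideal cell it is squeezed
around) is part 27Vb-V(B2), file `OverbindingBudgetAffineFarFieldCellSandwich`; the summed far-field
bound is part 27Vb-V(A), file `OverbindingBudgetAffineFarFieldCellSum`.
-/

namespace Summit.AtomisticToContinuum.Crystallization.Theorems.OverbindingBudgetAffineFarFieldCellLoose

noncomputable section

open Set Filter MeasureTheory
open scoped Topology
open Summit.AtomisticToContinuum.Crystallization.Theorems.OverbindingBudgetAffineFarFieldTaylor
open Summit.AtomisticToContinuum.Crystallization.Theorems.OverbindingBudgetAffineFarFieldCellTaylor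
open Summit.AtomisticToContinuum.Crystallization.Theorems.OverbindingBudgetAffineFarFieldCellSymm
open Summit.AtomisticToContinuum.Crystallization.Theorems.OverbindingBudgetAffineFarFieldCellMove
open Summit.AtomisticToContinuum.Crystallization.Theorems.OverbindingBudgetAffineFarFieldCellAffine

local notation "E3" => EuclideanSpace ℝ (Fin 3)

/-! ### Loose moment cells -/

/-- support: LOOSE MOMENT DATA of a cell `K` about `p` — `K` compact, star-shaped about `p ∈ K`,
`0 ≤ δ`, centroid defect `‖∫_K (x − p)‖ ≤ η·|K|`, second-moment form `= σ·|K|·tr` up to `δ·|K|·‖B‖`,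
third / fourth absolute moments `≤ μ₃|K|`, `≤ μ₄|K|`.  (`IsMomentCell` is the case `η = 0`.) -/
def IsLooseMomentCell (K : Set E3) (p : E3) (η σ δ μ₃ μ₄ : ℝ) : Prop :=
  IsCompact K ∧ StarConvex ℝ p K ∧ p ∈ K ∧ 0 ≤ δ ∧
  ‖∫ x in K, (x - p)‖ ≤ η * (volume K).toReal ∧
  (∀ B : E3 [×2]→L[ℝ] ℝ,
    |(∫ x in K, B (fun _ => x - p)) - σ * (volume K).toReal * ∑ i : Fin 3, B (fun _ => e3 i)|
      ≤ δ * (volume K).toReal * ‖B‖) ∧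
  (∫ x in K, ‖x - p‖ ^ 3) ≤ μ₃ * (volume K).toReal ∧
  (∫ x in K, ‖x - p‖ ^ 4) ≤ μ₄ * (volume K).toReal

/-- An exact moment cell is a loose moment cell with `η = 0`. -/
theorem IsMomentCell.loose {K : Set E3} {p : E3} {σ δ μ₃ μ₄ : ℝ}
    (hK : IsMomentCell K p σ δ μ₃ μ₄) : IsLooseMomentCell K p 0 σ δ μ₃ μ₄ := by
  obtain ⟨hKc, hKs, hpK, hδ, hM1, hM2, hM3, hM4⟩ := hK
  refine ⟨hKc, hKs, hpK, hδ, ?_, hM2, hM3, hM4⟩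
  rw [hM1, norm_zero, zero_mul]

/-- Rounding the constants of a loose moment cell up. -/
theorem IsLooseMomentCell.of_le {K : Set E3} {p : E3} {η σ δ μ₃ μ₄ η' δ' μ₃' μ₄' : ℝ}
    (hK : IsLooseMomentCell K p η σ δ μ₃ μ₄) (hη : η ≤ η') (hδ' : δ ≤ δ') (h3 : μ₃ ≤ μ₃')
    (h4 : μ₄ ≤ μ₄') : IsLooseMomentCell K p η' σ δ' μ₃' μ₄' := by
  obtain ⟨hKc, hKs, hpK, hδ, hM1, hM2, hM3, hM4⟩ := hK
  have hv : 0 ≤ (volume K).toReal := ENNReal.toReal_nonneg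
  refine ⟨hKc, hKs, hpK, hδ.trans hδ', hM1.trans (mul_le_mul_of_nonneg_right hη hv), ?_,
    hM3.trans (mul_le_mul_of_nonneg_right h3 hv), hM4.trans (mul_le_mul_of_nonneg_right h4 hv)⟩
  intro B
  exact (hM2 B).trans (mul_le_mul_of_nonneg_right (mul_le_mul_of_nonneg_right hδ' hv) (norm_nonneg _))

/-- A loose moment cell that is centrally symmetric about its point is an EXACT moment cell (the centroid
clause holds by symmetry): the chart-metric Voronoi cell of an ideal `k`-star regains exact data this way,
so only the `ε`-misplacement sliver is paid at first order (two-stage instance, part 27Vc). -/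
theorem IsLooseMomentCell.exact_of_centrallySymmetric {K : Set E3} {p : E3} {η σ δ μ₃ μ₄ : ℝ}
    (hK : IsLooseMomentCell K p η σ δ μ₃ μ₄) (hS : IsCentrallySymmetric K p) :
    IsMomentCell K p σ δ μ₃ μ₄ := by
  obtain ⟨hKc, hKs, hpK, hδ, -, hM2, hM3, hM4⟩ := hK
  exact ⟨hKc, hKs, hpK, hδ, integral_sub_eq_zero hS, hM2, hM3, hM4⟩

/-- The compactness clause. -/
theorem IsLooseMomentCell.isCompact {K : Set E3} {p : E3} {η σ δ μ₃ μ₄ : ℝ}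
    (hK : IsLooseMomentCell K p η σ δ μ₃ μ₄) : IsCompact K := hK.1

/-- The membership clause. -/
theorem IsLooseMomentCell.mem {K : Set E3} {p : E3} {η σ δ μ₃ μ₄ : ℝ}
    (hK : IsLooseMomentCell K p η σ δ μ₃ μ₄) : p ∈ K := hK.2.2.1

/-! ### The loose cell quadrature rule -/

/-- Core estimate: loose cell quadrature with an abstract bound `c₃` on the cubic term. -/
theorem cell_taylor_loose_core {K U : Set E3} {p : E3} {η σ δ μ₃ μ₄ : ℝ}
    (hK : IsLooseMomentCell K p η σ δ μ₃ μ₄)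
    (hU : IsOpen U) (hKU : K ⊆ U) {g : E3 → ℝ} (hg : ContDiffOn ℝ 4 g U) {D₁ D₂ D₄ c₃ : ℝ}
    (h1 : ‖fderiv ℝ g p‖ ≤ D₁) (h2 : ‖iteratedFDeriv ℝ 2 g p‖ ≤ D₂)
    (h3 : |∫ x in K, iteratedFDeriv ℝ 3 g p (fun _ => x - p)| ≤ (volume K).toReal * c₃)
    (h4 : ∀ x ∈ K, ‖iteratedFDeriv ℝ 4 g x‖ ≤ D₄) :
    |(∫ x in K, g x) - (volume K).toReal * (g p + σ / 2 * lap g p)|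
      ≤ (volume K).toReal * (η * D₁ + δ / 2 * D₂ + c₃ / 6 + μ₄ / 24 * D₄) := by
  obtain ⟨hKc, hKs, hpK, hδ, hM1, hM2, hM3, hM4⟩ := hK
  have hKm : MeasurableSet K := hKc.measurableSet
  set vol : ℝ := (volume K).toReal with hvol
  have hvol0 : 0 ≤ vol := ENNReal.toReal_nonneg
  set T₁ : E3 → ℝ := fun x => fderiv ℝ g p (x - p) with hT₁
  set T₂ : E3 → ℝ := fun x => iteratedFDeriv ℝ 2 g p (fun _ => x - p) with hT₂
  set T₃ : E3 → ℝ := fun x => iteratedFDeriv ℝ 3 g p (fun _ => x - p) with hT₃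
  set R : E3 → ℝ := fun x => g x - (g p + T₁ x + T₂ x / 2 + T₃ x / 6) with hR
  -- pointwise remainder bound on `K`
  have hRb : ∀ x ∈ K, ‖R x‖ ≤ D₄ / 24 * ‖x - p‖ ^ 4 := by
    intro x hx
    have hsegK : ∀ t ∈ Icc (0 : ℝ) 1, p + t • (x - p) ∈ K :=
      fun t ht => hKs.add_smul_sub_mem hx ht.1 ht.2
    have h := taylor_segment_three hU hg (fun t ht => hKU (hsegK t ht))
      (fun t ht => h4 _ (hsegK t ht))
    rw [Real.norm_eq_abs]
    simpa [hR, hT₁, hT₂, hT₃] using h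
  -- continuity and integrability on `K`
  have hsubc : Continuous fun x : E3 => x - p := continuous_id.sub continuous_const
  have hgc : ContinuousOn g K := hg.continuousOn.mono hKU
  have hT₁c : Continuous T₁ := (fderiv ℝ g p).continuous.comp hsubc
  have hT₂c : Continuous T₂ :=
    (iteratedFDeriv ℝ 2 g p).cont.comp (continuous_pi fun _ => hsubc)
  have hT₃c : Continuous T₃ :=
    (iteratedFDeriv ℝ 3 g p).cont.comp (continuous_pi fun _ => hsubc)
  have iG : IntegrableOn g K := hgc.integrableOn_compact hKc
  have iC : IntegrableOn (fun _ : E3 => g p) K := continuousOn_const.integrableOn_compact hKc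
  have iT₁ : IntegrableOn T₁ K := hT₁c.continuousOn.integrableOn_compact hKc
  have iT₂ : IntegrableOn T₂ K := hT₂c.continuousOn.integrableOn_compact hKc
  have iT₃ : IntegrableOn T₃ K := hT₃c.continuousOn.integrableOn_compact hKc
  have iS : IntegrableOn (fun x => g p + T₁ x + T₂ x / 2 + T₃ x / 6) K :=
    ((iC.add iT₁).add (iT₂.div_const 2)).add (iT₃.div_const 6)
  have iR : IntegrableOn R K := iG.sub iS
  have i4 : IntegrableOn (fun x : E3 => ‖x - p‖ ^ 4) K :=
    ((continuous_norm.comp hsubc).pow 4).continuousOn.integrableOn_compact hKc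
  have iV : IntegrableOn (fun x : E3 => x - p) K := hsubc.continuousOn.integrableOn_compact hKc
  -- split the integral
  have hsplit : (∫ x in K, g x) = (∫ x in K, R x) + ((∫ x in K, (fun _ : E3 => g p) x)
      + (∫ x in K, T₁ x) + (∫ x in K, T₂ x / 2) + (∫ x in K, T₃ x / 6)) := by
    have e0 : (∫ x in K, g x) = ∫ x in K, (R x + (g p + T₁ x + T₂ x / 2 + T₃ x / 6)) := by
      congr 1; funext x; simp only [hR]; ring
    have iCT : Integrable (fun x => g p + T₁ x) (volume.restrict K) := iC.add iT₁
    have iCT2 : Integrable (fun x => g p + T₁ x + T₂ x / 2) (volume.restrict K) :=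
      iCT.add (iT₂.div_const 2)
    have a1 : (∫ x in K, (g p + T₁ x + T₂ x / 2 + T₃ x / 6))
        = (∫ x in K, (g p + T₁ x + T₂ x / 2)) + ∫ x in K, T₃ x / 6 :=
      integral_add iCT2 (iT₃.div_const 6)
    have a2 : (∫ x in K, (g p + T₁ x + T₂ x / 2))
        = (∫ x in K, (g p + T₁ x)) + ∫ x in K, T₂ x / 2 := integral_add iCT (iT₂.div_const 2)
    have a3 : (∫ x in K, (g p + T₁ x)) = (∫ x in K, (fun _ : E3 => g p) x) + ∫ x in K, T₁ x :=
      integral_add iC iT₁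
    rw [e0, integral_add iR iS, a1, a2, a3]
  -- the pieces
  have vC : (∫ x in K, (fun _ : E3 => g p) x) = vol * g p := by
    simp [measureReal_def, hvol]
  have vT₁ : |∫ x in K, T₁ x| ≤ vol * (η * D₁) := by
    have h := (fderiv ℝ g p).integral_comp_comm (μ := volume.restrict K) iV
    have e : (∫ x in K, T₁ x) = fderiv ℝ g p (∫ x in K, (x - p)) := by
      simp only [hT₁]; exact h
    rw [e, ← Real.norm_eq_abs]
    have hD₁ : 0 ≤ D₁ := (norm_nonneg _).trans h1
    calc ‖fderiv ℝ g p (∫ x in K, (x - p))‖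
        ≤ ‖fderiv ℝ g p‖ * ‖∫ x in K, (x - p)‖ := ContinuousLinearMap.le_opNorm _ _
      _ ≤ D₁ * (η * vol) := mul_le_mul h1 hM1 (norm_nonneg _) hD₁
      _ = vol * (η * D₁) := by ring
  have vT₂ : |(∫ x in K, T₂ x) - σ * vol * lap g p| ≤ δ * vol * D₂ := by
    have h := hM2 (iteratedFDeriv ℝ 2 g p)
    have h' : δ * vol * ‖iteratedFDeriv ℝ 2 g p‖ ≤ δ * vol * D₂ := by
      have : 0 ≤ δ * vol := mul_nonneg hδ hvol0
      exact mul_le_mul_of_nonneg_left h2 this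
    simpa [hT₂, lap] using h.trans h'
  have vR : |∫ x in K, R x| ≤ vol * (μ₄ / 24 * D₄) := by
    have hD₄ : 0 ≤ D₄ := (norm_nonneg _).trans (h4 p hpK)
    have h1' : ‖∫ x in K, R x‖ ≤ ∫ x in K, D₄ / 24 * ‖x - p‖ ^ 4 :=
      norm_integral_le_of_norm_le (i4.const_mul (D₄ / 24)) (ae_restrict_of_forall_mem hKm hRb)
    rw [integral_const_mul, Real.norm_eq_abs] at h1'
    calc |∫ x in K, R x| ≤ D₄ / 24 * ∫ x in K, ‖x - p‖ ^ 4 := h1'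
      _ ≤ D₄ / 24 * (μ₄ * vol) := by gcongr
      _ = vol * (μ₄ / 24 * D₄) := by ring
  have e2 : (∫ x in K, T₂ x / 2) = (∫ x in K, T₂ x) / 2 := integral_div 2 T₂
  have e3' : (∫ x in K, T₃ x / 6) = (∫ x in K, T₃ x) / 6 := integral_div 6 T₃
  have key : (∫ x in K, g x) - vol * (g p + σ / 2 * lap g p)
      = (∫ x in K, R x) + (∫ x in K, T₁ x) + ((∫ x in K, T₂ x) - σ * vol * lap g p) / 2
        + (∫ x in K, T₃ x) / 6 := by
    rw [hsplit, vC, e2, e3']; ring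
  rw [key]
  have h3' : |∫ x in K, T₃ x| ≤ vol * c₃ := by simpa [hT₃] using h3
  calc |(∫ x in K, R x) + (∫ x in K, T₁ x) + ((∫ x in K, T₂ x) - σ * vol * lap g p) / 2
          + (∫ x in K, T₃ x) / 6|
      ≤ |∫ x in K, R x| + |∫ x in K, T₁ x| + |((∫ x in K, T₂ x) - σ * vol * lap g p) / 2|
          + |(∫ x in K, T₃ x) / 6| := by
          have t1 := abs_add_le ((∫ x in K, R x) + (∫ x in K, T₁ x)
            + ((∫ x in K, T₂ x) - σ * vol * lap g p) / 2) ((∫ x in K, T₃ x) / 6)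
          have t2 := abs_add_le ((∫ x in K, R x) + (∫ x in K, T₁ x))
            (((∫ x in K, T₂ x) - σ * vol * lap g p) / 2)
          have t3 := abs_add_le (∫ x in K, R x) (∫ x in K, T₁ x)
          linarith
    _ = |∫ x in K, R x| + |∫ x in K, T₁ x| + |(∫ x in K, T₂ x) - σ * vol * lap g p| / 2
          + |∫ x in K, T₃ x| / 6 := by
        rw [abs_div, abs_div, abs_of_pos (by norm_num : (0:ℝ) < 2),
          abs_of_pos (by norm_num : (0:ℝ) < 6)]
    _ ≤ vol * (μ₄ / 24 * D₄) + vol * (η * D₁) + (δ * vol * D₂) / 2 + (vol * c₃) / 6 := by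
        gcongr
    _ = vol * (η * D₁ + δ / 2 * D₂ + c₃ / 6 + μ₄ / 24 * D₄) := by ring

/-- **Loose cell quadrature rule (general cell).**
`|∫_K g − |K|(g(p) + (σ/2)Δg(p))| ≤ |K|(η‖Dg(p)‖ + (δ/2)‖D²g(p)‖ + (μ₃/6)‖D³g(p)‖ + (μ₄/24) sup_K ‖D⁴g‖)`. -/
theorem cell_taylor_loose {K U : Set E3} {p : E3} {η σ δ μ₃ μ₄ : ℝ}
    (hK : IsLooseMomentCell K p η σ δ μ₃ μ₄)
    (hU : IsOpen U) (hKU : K ⊆ U) {g : E3 → ℝ} (hg : ContDiffOn ℝ 4 g U) {D₁ D₂ D₃ D₄ : ℝ}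
    (h1 : ‖fderiv ℝ g p‖ ≤ D₁) (h2 : ‖iteratedFDeriv ℝ 2 g p‖ ≤ D₂)
    (h3 : ‖iteratedFDeriv ℝ 3 g p‖ ≤ D₃) (h4 : ∀ x ∈ K, ‖iteratedFDeriv ℝ 4 g x‖ ≤ D₄) :
    |(∫ x in K, g x) - (volume K).toReal * (g p + σ / 2 * lap g p)|
      ≤ (volume K).toReal * (η * D₁ + δ / 2 * D₂ + μ₃ / 6 * D₃ + μ₄ / 24 * D₄) := by
  have hK' := hK
  obtain ⟨hKc, hKs, hpK, hδ, hM1, hM2, hM3, hM4⟩ := hK'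
  have hKm : MeasurableSet K := hKc.measurableSet
  have hsubc : Continuous fun x : E3 => x - p := continuous_id.sub continuous_const
  have i3 : IntegrableOn (fun x : E3 => ‖x - p‖ ^ 3) K :=
    ((continuous_norm.comp hsubc).pow 3).continuousOn.integrableOn_compact hKc
  have hD₃ : 0 ≤ D₃ := (norm_nonneg _).trans h3
  have hpt : ∀ x ∈ K, ‖iteratedFDeriv ℝ 3 g p (fun _ => x - p)‖ ≤ D₃ * ‖x - p‖ ^ 3 := by
    intro x _
    have h := (iteratedFDeriv ℝ 3 g p).le_opNorm (fun _ => x - p)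
    simp only [Finset.prod_const, Finset.card_univ, Fintype.card_fin] at h
    exact h.trans (by gcongr)
  have h1' : ‖∫ x in K, iteratedFDeriv ℝ 3 g p (fun _ => x - p)‖ ≤ ∫ x in K, D₃ * ‖x - p‖ ^ 3 :=
    norm_integral_le_of_norm_le (i3.const_mul D₃) (ae_restrict_of_forall_mem hKm hpt)
  rw [integral_const_mul, Real.norm_eq_abs] at h1'
  have h3' : |∫ x in K, iteratedFDeriv ℝ 3 g p (fun _ => x - p)|
      ≤ (volume K).toReal * (μ₃ * D₃) :=
    calc _ ≤ D₃ * ∫ x in K, ‖x - p‖ ^ 3 := h1'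
      _ ≤ D₃ * (μ₃ * (volume K).toReal) := by gcongr
      _ = (volume K).toReal * (μ₃ * D₃) := by ring
  have h := cell_taylor_loose_core hK hU hKU hg h1 h2 h3' h4
  calc _ ≤ (volume K).toReal * (η * D₁ + δ / 2 * D₂ + μ₃ * D₃ / 6 + μ₄ / 24 * D₄) := h
    _ = (volume K).toReal * (η * D₁ + δ / 2 * D₂ + μ₃ / 6 * D₃ + μ₄ / 24 * D₄) := by ring

/-- **Loose cell quadrature rule, structured cubic clause** (`τ`-form, the one the far-field sum consumes):
if every cubic form integrates over `K` to at most `τ·|K|·‖B‖`, the cubic error term is `(τ/6) D₃`. -/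
theorem cell_taylor_loose_tau {K U : Set E3} {p : E3} {η σ δ μ₃ μ₄ τ : ℝ}
    (hK : IsLooseMomentCell K p η σ δ μ₃ μ₄) (hτ0 : 0 ≤ τ)
    (hτ : ∀ B : E3 [×3]→L[ℝ] ℝ, |∫ x in K, B (fun _ => x - p)| ≤ τ * (volume K).toReal * ‖B‖)
    (hU : IsOpen U) (hKU : K ⊆ U) {g : E3 → ℝ} (hg : ContDiffOn ℝ 4 g U) {D₁ D₂ D₃ D₄ : ℝ}
    (h1 : ‖fderiv ℝ g p‖ ≤ D₁) (h2 : ‖iteratedFDeriv ℝ 2 g p‖ ≤ D₂)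
    (h3 : ‖iteratedFDeriv ℝ 3 g p‖ ≤ D₃) (h4 : ∀ x ∈ K, ‖iteratedFDeriv ℝ 4 g x‖ ≤ D₄) :
    |(∫ x in K, g x) - (volume K).toReal * (g p + σ / 2 * lap g p)|
      ≤ (volume K).toReal * (η * D₁ + δ / 2 * D₂ + τ / 6 * D₃ + μ₄ / 24 * D₄) := by
  have hτv : 0 ≤ τ * (volume K).toReal := mul_nonneg hτ0 ENNReal.toReal_nonneg
  have h3' : |∫ x in K, iteratedFDeriv ℝ 3 g p (fun _ => x - p)|
      ≤ (volume K).toReal * (τ * D₃) :=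
    calc _ ≤ τ * (volume K).toReal * ‖iteratedFDeriv ℝ 3 g p‖ := hτ _
      _ ≤ τ * (volume K).toReal * D₃ := mul_le_mul_of_nonneg_left h3 hτv
      _ = (volume K).toReal * (τ * D₃) := by ring
  have h := cell_taylor_loose_core hK hU hKU hg h1 h2 h3' h4
  calc _ ≤ (volume K).toReal * (η * D₁ + δ / 2 * D₂ + τ * D₃ / 6 + μ₄ / 24 * D₄) := h
    _ = (volume K).toReal * (η * D₁ + δ / 2 * D₂ + τ / 6 * D₃ + μ₄ / 24 * D₄) := by ring

/-- A centrally symmetric cell satisfies the structured cubic clause with `τ = 0`. -/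
theorem cubic_clause_of_centrallySymmetric {K : Set E3} {p : E3} (hS : IsCentrallySymmetric K p)
    (B : E3 [×3]→L[ℝ] ℝ) :
    |∫ x in K, B (fun _ => x - p)| ≤ 0 * (volume K).toReal * ‖B‖ := by
  rw [integral_cubic_eq_zero hS B]; simp

end

end Summit.AtomisticToContinuum.Crystallization.Theorems.OverbindingBudgetAffineFarFieldCellLoose
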